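import Summits.QuantumFields.BalabanUV.Beta.D1BFx.RProjector

/-!
# `BalabanUV.Beta.D1BFx.RProjectorRange` — road «BF-x» for binder row D1, sub-leaf J5.0 part 2: the `U = 1` gauge-term projector
# `P = G′Q′*(Q′G′²Q′*)⁻¹Q′G′` (B9 (3.25)) IS A PROJECTION ONTO THE RANGE OF `G′Q′*` — `Q′G′·P = Q′G′` (equivalently `Q′G′·R = 0`,
# `R = 1 − P`) and `P² = P`, as kernel identities on the whole fine lattice `ℤ^d`

HONEST FRAMING (cell contract, verbatim): «discharging `BetaPertH` makes Bałaban's UV stability UNCONDITIONAL — a real constructive-QFT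
result; it is NOT the continuum limit and NOT the Clay problem.»  HONEST DEPENDENCY (verbatim): «continuum YM on T⁴ ⇐ BetaPertH ∧ nine
spine estimates (0/9 proved); BetaPertH ⇐ (D1) ∧ (D4) ∧ CAP+tail; G-an2-4 gates asym, D1 and NE2/3/4.»  THIS MODULE DISCHARGES NOTHING:
[folklore] lattice bookkeeping (block-by-block summation and Fubini under exponential majorants) composed BY NAME from
`D1BFx/RProjector` (this seat, part 1: `kerP`, `Pker`, `abs_kerP_le`, `abs_Pker_le`, `Pker_symm`, `sum_mul_kerP`, `sum_mul_Pker`,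
`tsum_kerSq_mul_Csq`, `abs_tsum_le_latticeConst`), pv23's `B6QGGQ278Zd` (`kerSq`, `Csq`, `abs_Csq_le`, `abs_blockSum_le`, `summable_gq_mul_gq`)
and `B5Hk103ScalarZd` (`gq`, `abs_gq_le`, `tsum_blocks`, `tsum_mul_tsum_comm`, `summable_Gk_row`).  No `def`, no `Prop` minted, nothing
printed asserted; 0 sorry.  NOT summit progress; NOT BetaPertH, NOT continuum, NOT Clay.
ABSOLUTE RULE (cell, verbatim): «No internally-minted statement may enter as a cited fact. Every hypothesis is either kernel-proved in this
package or a verbatim quotation of a PUBLISHED theorem with page reference. The manuscript(s) under audit are NOT citable for their own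
disputed steps — they are the thing under adjudication; programme-internal (2001/route/tribunal) claims are never citable.»

WHY.  Part 1 proved that `P` is symmetric, block-structured, and annihilates `Δ₀N(Q′)` («`R = 1` on `Δ_U N(Q′)`», B9 (3.21), CONTEXT).  This part
proves the complementary half: `P` is the identity on the range of `G′Q′*` in the precise kernel form `Σ'_p (G′Q′*)(p,y)·P(p,q) = (G′Q′*)(q,y)`
(`tsum_gq_mul_Pker`, i.e. `Q′G′·(1 − P) = 0`, the `U = 1` shape of B5 (1.95)'s «QG∂R = 0» for the scalar tower — CONTEXT, not a hypothesis) and is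
idempotent (`tsum_Pker_mul_Pker`), so `R = 1 − P` is an (orthogonal, `P` being symmetric) projection killing exactly `Range(G′Q′*)`.  Together with
part 1 this is what the road's K-R1/K-R2 need of the `U = 1` operator `R` of the weighted datum `Δ_R = d*d + ∂R∂*` (CHECK-K-R2 §3 (R2-a), §6).

CONTENT (all [folklore]; conventions of part 1: `d` arbitrary, block side `n + 1`, `a > 0`).  §1 `Gk_symm`, `summable_gq_col`, `summable_gq_mul_Pker`,
`bb` bookkeeping (`sum_B_gq_mul_kerP`, `abs_tsum_bb_Csq_le`), `tsum_bb_eq_kerSq`.  §2 **`tsum_gq_mul_Pker`** (`Q′G′·P = Q′G′`).  §3 **`tsum_Pker_mul_Pker`**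
(`P² = P`).  §4 road currency: `tsum_Pgt_mul_Pgt`.
-/

namespace Summit.QuantumFields.BalabanUV.Beta.D1BFx.RProjectorRange

open Finset Real Filter Topology
open Literature.MathematicalPhysics.QuantumFieldTheory.Balaban1983to89
open B4Sect5Exhaustion (limInv limInv_symm)
open B4Sect5Proof (latticeConst latticeConst_nonneg)
open B6QGQLower276 (X blk B mem_B hyp56Z_Aker c0_pos sum_B_const chart blk_chart card_cube)
open B6QGQDecay237 (cU deltaU cU_pos deltaU_pos)
open B5Hk103ScalarZd (Gk gq abs_gq_le summable_expX tsum_expX_le exp_split_triangle tsum_mul_tsum_comm tsum_blocks summable_Gk_row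
  blockEquiv)
open B6QGGQ278Zd (kerSq Csq cC deltaC cC_pos deltaC_pos abs_Csq_le abs_blockSum_le summable_gq_mul_gq)
open Summit.QuantumFields.BalabanUV.Beta.D1BFx.RProjector

noncomputable section

variable {d : ℕ}

/-! ## §1 Bookkeeping: columns of `G′Q′*`, block pieces, and their sums -/

/-- [folklore] `G′` is symmetric (B4 Sect. 5 inverse of the symmetric site matrix). -/
theorem Gk_symm (n : ℕ) {a : ℝ} (ha : 0 < a) (p q : X d) : Gk n a p q = Gk n a q p :=
  limInv_symm (lt_min two_pos ha) (c0_pos d n ha.ne') one_pos (hyp56Z_Aker n a) (p, 0) (q, 0)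

/-- [folklore] Columns of `G′Q′*` are summable over the fine lattice. -/
theorem summable_gq_col (n : ℕ) {a : ℝ} (ha : 0 < a) (y : X d) : Summable fun p : X d => gq n a p y := by
  have e : (fun p : X d => gq n a p y) = fun p => ∑ q ∈ B n y, Gk n a q p := by
    funext p; rw [gq]; exact Finset.sum_congr rfl fun q _ => Gk_symm n ha p q
  rw [e]
  exact summable_sum fun q _ => summable_Gk_row n ha q

/-- [folklore] `p ↦ (G′Q′*)(p,y)·P(p,q)` is summable over the fine lattice (`P` is bounded). -/
theorem summable_gq_mul_Pker (n : ℕ) {a : ℝ} (ha : 0 < a) (y q : X d) :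
    Summable fun p : X d => gq n a p y * Pker n a p q := by
  refine Summable.of_norm_bounded (((summable_gq_col n ha y).abs).mul_right (cPP d n a)) fun p => ?_
  rw [Real.norm_eq_abs, abs_mul]
  refine mul_le_mul_of_nonneg_left ((abs_Pker_le n ha p q).trans ?_) (abs_nonneg _)
  have he : Real.exp (-(deltaPP d a * dist (blk n p) (blk n q))) ≤ 1 := by
    rw [Real.exp_le_one_iff, neg_nonpos]; exact mul_nonneg (deltaPP_pos d ha).le dist_nonneg
  have h0 := cPP_nonneg d n ha
  nlinarith

/-- [folklore] One block of the series `Σ_p (G′Q′*)(p,y)·(G′Q′*C)(p,y₁)`, through `sum_mul_kerP`: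
`Σ_{p∈B(w)} (G′Q′*)(p,y)(G′Q′*C)(p,y₁) = Σ'_{y₂} [Σ_{p∈B(w)} (G′Q′*)(p,y)(G′Q′*)(p,y₂)]·C(y₂,y₁)`. -/
theorem sum_B_gq_mul_kerP (n : ℕ) {a : ℝ} (ha : 0 < a) (w y y₁ : X d) :
    ∑ p ∈ B n w, gq n a p y * kerP n a p y₁
      = ∑' y₂ : X d, (∑ p ∈ B n w, gq n a p y * gq n a p y₂) * Csq n a y₂ y₁ :=
  sum_mul_kerP n ha (B n w) (fun p => gq n a p y) y₁

/-- [folklore] Bound for the block series: `|Σ'_{y₂} bb(w;y,y₂)·C(y₂,y₁)| ≤ c_u²(n+1)^d c_C K_d(δ_C/2)·e^{−δ_u|w−y|}·e^{−δ_P|w−y₁|}`. -/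
theorem abs_tsum_bb_Csq_le (n : ℕ) {a : ℝ} (ha : 0 < a) (w y y₁ : X d) :
    |∑' y₂ : X d, (∑ p ∈ B n w, gq n a p y * gq n a p y₂) * Csq n a y₂ y₁|
      ≤ (cU d a ^ 2 * ((n : ℝ) + 1) ^ d * cC d a * Real.exp (-(deltaU d a * dist w y))
          * Real.exp (-(deltaP d a * dist w y₁))) * latticeConst d (deltaC d a / 2) := by
  have hδu := deltaU_pos d ha
  have hδC := deltaC_pos d ha
  have hc : 0 ≤ cU d a ^ 2 * ((n : ℝ) + 1) ^ d * cC d a := by have := cC_pos d ha; positivity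
  refine abs_tsum_le_latticeConst (half_pos hδC) (by positivity) y₁ fun y₂ => ?_
  rw [abs_mul]
  have h1 := abs_blockSum_le n ha w y y₂
  have h2 := abs_Csq_le n ha y₂ y₁
  have hsplit := exp_split_triangle hδu.le hδC.le (dist_nonneg (x := w) (y := y₂)) (dist_nonneg (x := y₂) (y := y₁))
    (dist_triangle w y₂ y₁)
  rw [dist_comm y₂ y₁] at hsplit
  calc |∑ p ∈ B n w, gq n a p y * gq n a p y₂| * |Csq n a y₂ y₁|
      ≤ (cU d a ^ 2 * ((n : ℝ) + 1) ^ d * (Real.exp (-(deltaU d a * dist w y)) * Real.exp (-(deltaU d a * dist w y₂))))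
          * (cC d a * Real.exp (-(deltaC d a * dist y₂ y₁))) :=
        mul_le_mul h1 h2 (abs_nonneg _) (by positivity)
    _ = cU d a ^ 2 * ((n : ℝ) + 1) ^ d * cC d a * Real.exp (-(deltaU d a * dist w y))
          * (Real.exp (-(deltaU d a * dist w y₂)) * Real.exp (-(deltaC d a * dist y₁ y₂))) := by
        rw [dist_comm y₂ y₁]; ring
    _ ≤ cU d a ^ 2 * ((n : ℝ) + 1) ^ d * cC d a * Real.exp (-(deltaU d a * dist w y))
          * (Real.exp (-(min (deltaU d a) (deltaC d a) / 2 * dist w y₁)) * Real.exp (-(deltaC d a / 2 * dist y₁ y₂))) :=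
        mul_le_mul_of_nonneg_left hsplit (by positivity)
    _ = cU d a ^ 2 * ((n : ℝ) + 1) ^ d * cC d a * Real.exp (-(deltaU d a * dist w y))
          * Real.exp (-(deltaP d a * dist w y₁)) * Real.exp (-(deltaC d a / 2 * dist y₁ y₂)) := by
        rw [deltaP]; ring

/-- [folklore] **The block pieces of `(G′Q′*)ᵀ(G′Q′*)` sum to `(n+1)^d·(Q′G′²Q′*)`**: `Σ'_w Σ_{p∈B(w)} (G′Q′*)(p,y)(G′Q′*)(p,y₂) = (n+1)^d·kerSq(y,y₂)`. -/
theorem tsum_bb_eq_kerSq (n : ℕ) {a : ℝ} (ha : 0 < a) (y y₂ : X d) :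
    ∑' w : X d, ∑ p ∈ B n w, gq n a p y * gq n a p y₂ = ((n : ℝ) + 1) ^ d * kerSq n a y y₂ := by
  rw [tsum_blocks n (summable_gq_mul_gq n ha y y₂), kerSq, ← mul_assoc,
    mul_inv_cancel₀ (by positivity : (((n : ℝ) + 1) ^ d) ≠ 0), one_mul]

/-! ## §2 `Q′G′·P = Q′G′` (the projector is the identity on the range of `G′Q′*`; `Q′G′·R = 0`) -/

/-- [folklore] **`Q′G′·P = Q′G′` ON `ℤ^d`**: for every block `y` and fine site `q`, `Σ'_p (G′Q′*)(p,y)·P(p,q) = (G′Q′*)(q,y)`.  Proof: sum block by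
block; inside a block use `sum_mul_Pker`/`sum_mul_kerP`; exchange the block sum with the two coarse series (Fubini under the exponential
majorants of `abs_blockSum_le`, `abs_Csq_le`); the block pieces re-assemble to `(n+1)^d·(Q′G′²Q′*)` (`tsum_bb_eq_kerSq`), which `C` inverts
(`tsum_kerSq_mul_Csq`). -/
theorem tsum_gq_mul_Pker (n : ℕ) {a : ℝ} (ha : 0 < a) (y q : X d) :
    ∑' p : X d, gq n a p y * Pker n a p q = gq n a q y := by
  classical
  have hδu := deltaU_pos d ha
  have hδC := deltaC_pos d ha
  have hδP := deltaP_pos d ha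
  have hN : (0 : ℝ) < ((n : ℝ) + 1) ^ d := by positivity
  set η : ℝ := (((n : ℝ) + 1) ^ d)⁻¹ with hη
  set bb : X d → X d → ℝ := fun w y₂ => ∑ p ∈ B n w, gq n a p y * gq n a p y₂ with hbb
  set K₁ : ℝ := cU d a ^ 2 * ((n : ℝ) + 1) ^ d * cC d a with hK₁
  have hK₁0 : 0 ≤ K₁ := by rw [hK₁]; have := cC_pos d ha; positivity
  -- (1) block by block
  rw [← tsum_blocks n (summable_gq_mul_Pker n ha y q)]
  -- (2) inside each block: `Σ_{p∈B w} gq·P = η·Σ'_{y₁} (Σ'_{y₂} bb w y₂ · C y₂ y₁) · gq q y₁`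
  have hblock : ∀ w : X d, ∑ p ∈ B n w, gq n a p y * Pker n a p q
      = η * ∑' y₁ : X d, (∑' y₂ : X d, bb w y₂ * Csq n a y₂ y₁) * gq n a q y₁ := by
    intro w
    rw [sum_mul_Pker n ha (B n w) (fun p => gq n a p y) q]
    exact congrArg _ (tsum_congr fun y₁ => by rw [sum_B_gq_mul_kerP n ha w y y₁])
  simp_rw [hblock]
  rw [tsum_mul_left]
  -- (3) exchange the block sum `w` with the `y₁` series
  have hmaj₁ : ∀ w y₁ : X d, |(1 : ℝ) * ((∑' y₂ : X d, bb w y₂ * Csq n a y₂ y₁) * gq n a q y₁)|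
      ≤ (K₁ * latticeConst d (deltaC d a / 2) * (cU d a * Real.sqrt (((n : ℝ) + 1) ^ d)))
        * Real.exp (-(deltaU d a * dist y w)) * Real.exp (-(deltaP d a * dist w y₁)) := by
    intro w y₁
    rw [one_mul, abs_mul]
    have h1 := abs_tsum_bb_Csq_le n ha w y y₁
    have h2 := abs_gq_le_const n ha q y₁
    have hL := latticeConst_nonneg d (half_pos hδC).le
    calc |∑' y₂ : X d, bb w y₂ * Csq n a y₂ y₁| * |gq n a q y₁|
        ≤ ((K₁ * Real.exp (-(deltaU d a * dist w y)) * Real.exp (-(deltaP d a * dist w y₁))) * latticeConst d (deltaC d a / 2))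
            * (cU d a * Real.sqrt (((n : ℝ) + 1) ^ d)) := mul_le_mul h1 h2 (abs_nonneg _) (by positivity)
      _ = _ := by rw [dist_comm w y]; ring
  have hswap := tsum_mul_tsum_comm (f := fun _ : X d => (1 : ℝ))
    (g := fun w y₁ => (∑' y₂ : X d, bb w y₂ * Csq n a y₂ y₁) * gq n a q y₁) hδu hδP y hmaj₁
  simp only [one_mul] at hswap
  rw [hswap]
  -- (4) for fixed `y₁`: exchange `w` with `y₂`, re-assemble the block pieces, invert with `C`
  have hinner : ∀ y₁ : X d, ∑' w : X d, (∑' y₂ : X d, bb w y₂ * Csq n a y₂ y₁) * gq n a q y₁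
      = ((n : ℝ) + 1) ^ d * ((if y = y₁ then 1 else 0) * gq n a q y₁) := by
    intro y₁
    have hmaj₂ : ∀ w y₂ : X d, |(1 : ℝ) * (bb w y₂ * Csq n a y₂ y₁)|
        ≤ (K₁) * Real.exp (-(deltaU d a * dist y w)) * Real.exp (-(deltaU d a * dist w y₂)) := by
      intro w y₂
      rw [one_mul, abs_mul]
      have h1 := abs_blockSum_le n ha w y y₂
      have h2 : |Csq n a y₂ y₁| ≤ cC d a := by
        refine (abs_Csq_le n ha y₂ y₁).trans ?_
        have he : Real.exp (-(deltaC d a * dist y₂ y₁)) ≤ 1 := by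
          rw [Real.exp_le_one_iff, neg_nonpos]; exact mul_nonneg hδC.le dist_nonneg
        have := cC_pos d ha
        nlinarith
      calc |bb w y₂| * |Csq n a y₂ y₁|
          ≤ (cU d a ^ 2 * ((n : ℝ) + 1) ^ d * (Real.exp (-(deltaU d a * dist w y)) * Real.exp (-(deltaU d a * dist w y₂))))
              * cC d a := mul_le_mul h1 h2 (abs_nonneg _) (by positivity)
        _ = _ := by rw [hK₁, dist_comm w y]; ring
    have hswap₂ := tsum_mul_tsum_comm (f := fun _ : X d => (1 : ℝ)) (g := fun w y₂ => bb w y₂ * Csq n a y₂ y₁) hδu hδu y hmaj₂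
    simp only [one_mul] at hswap₂
    rw [tsum_mul_right, hswap₂]
    have hcol : ∀ y₂ : X d, ∑' w : X d, bb w y₂ * Csq n a y₂ y₁ = ((n : ℝ) + 1) ^ d * (kerSq n a y y₂ * Csq n a y₂ y₁) := by
      intro y₂
      rw [tsum_mul_right, hbb]
      show (∑' w : X d, ∑ p ∈ B n w, gq n a p y * gq n a p y₂) * Csq n a y₂ y₁ = _
      rw [tsum_bb_eq_kerSq n ha y y₂, mul_assoc]
    simp_rw [hcol]
    rw [tsum_mul_left, tsum_kerSq_mul_Csq n ha y y₁, mul_assoc]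
  simp_rw [hinner]
  rw [tsum_mul_left, ← mul_assoc, hη, inv_mul_cancel₀ hN.ne', one_mul]
  simp_rw [ite_mul, one_mul, zero_mul]
  have e : (fun x : X d => if y = x then gq n a q x else 0) = fun x => if x = y then gq n a q y else 0 := by
    funext x
    by_cases hx : x = y
    · subst hx; simp
    · rw [if_neg hx, if_neg (Ne.symm hx)]
  rw [e, tsum_ite_eq]

/-! ## §3 `P² = P` -/

/-- [folklore] A fine-lattice function dominated by `C·e^{−δ|x − blk r|_∞}` (a BLOCK majorant) is summable over `ℤ^d` (each block has
`(n+1)^d` sites; `B5Hk103ScalarZd.blockEquiv`). -/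
theorem summable_of_blk_majorant (n : ℕ) {f : X d → ℝ} {C δ : ℝ} (hδ : 0 < δ) (x : X d)
    (h : ∀ r, |f r| ≤ C * Real.exp (-(δ * dist x (blk n r)))) : Summable f := by
  rw [← (blockEquiv (d := d) n).summable_iff]
  set g : X d × (Fin d → Fin (n + 1)) → ℝ := fun wz => |C| * Real.exp (-(δ * dist x wz.1)) with hg
  have hg0 : 0 ≤ g := fun wz => by simp only [hg]; positivity
  have hgs : Summable g := by
    refine (summable_prod_of_nonneg hg0).2 ⟨fun w => (hasSum_fintype _).summable, ?_⟩
    have e : (fun w : X d => ∑' z : Fin d → Fin (n + 1), g (w, z))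
        = fun w => (|C| * ((n : ℝ) + 1) ^ d) * Real.exp (-(δ * dist x w)) := by
      funext w
      simp only [hg, tsum_fintype, Finset.sum_const, Finset.card_univ, nsmul_eq_mul]
      rw [card_cube]; ring
    rw [e]
    exact (summable_expX hδ x).mul_left _
  refine Summable.of_norm_bounded hgs fun wz => ?_
  rw [Real.norm_eq_abs]
  have h1 := h (blockEquiv (d := d) n wz)
  have hb : blk n (blockEquiv (d := d) n wz) = wz.1 := blk_chart n wz.1 wz.2
  rw [hb] at h1
  refine h1.trans ?_
  simp only [hg]
  exact mul_le_mul_of_nonneg_right (le_abs_self C) (Real.exp_pos _).le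

/-- [folklore] `w ↦ Σ_{r∈B(w)} P(p,r)·(G′Q′*)(r,y)`: the block pieces of `Σ'_r P(p,r)(G′Q′*)(r,y)` obey the Fubini majorant. -/
theorem abs_sum_B_Pker_mul_gq_le (n : ℕ) {a : ℝ} (ha : 0 < a) (p w y : X d) :
    |∑ r ∈ B n w, Pker n a p r * gq n a r y|
      ≤ (((n : ℝ) + 1) ^ d * cPP d n a * (cU d a * Real.sqrt (((n : ℝ) + 1) ^ d)))
        * Real.exp (-(deltaPP d a * dist (blk n p) w)) * Real.exp (-(deltaU d a * dist w y)) := by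
  refine (Finset.abs_sum_le_sum_abs _ _).trans ?_
  have hterm : ∀ r ∈ B n w, |Pker n a p r * gq n a r y|
      ≤ cPP d n a * (cU d a * Real.sqrt (((n : ℝ) + 1) ^ d))
        * Real.exp (-(deltaPP d a * dist (blk n p) w)) * Real.exp (-(deltaU d a * dist w y)) := by
    intro r hr
    rw [abs_mul]
    have h1 := abs_Pker_le n ha p r
    have h2 := abs_gq_le n ha r y
    rw [mem_B.1 hr] at h1 h2
    calc |Pker n a p r| * |gq n a r y|
        ≤ (cPP d n a * Real.exp (-(deltaPP d a * dist (blk n p) w)))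
            * (cU d a * Real.sqrt (((n : ℝ) + 1) ^ d) * Real.exp (-(deltaU d a * dist w y))) :=
          mul_le_mul h1 h2 (abs_nonneg _) (by have := cPP_nonneg d n ha; positivity)
      _ = _ := by ring
  refine (Finset.sum_le_sum hterm).trans (le_of_eq ?_)
  rw [sum_B_const]; ring

/-- [folklore] **`P² = P` ON `ℤ^d`**: `Σ'_r P(p,r)·P(r,q) = P(p,q)` — `P(r,q) = (n+1)^{−d}Σ'_y (G′Q′*C)(q,y)(G′Q′*)(r,y)` (symmetry), block-by-block
summation, one Fubini, and `Q′G′·P = Q′G′` (`tsum_gq_mul_Pker`). -/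
theorem tsum_Pker_mul_Pker (n : ℕ) {a : ℝ} (ha : 0 < a) (p q : X d) :
    ∑' r : X d, Pker n a p r * Pker n a r q = Pker n a p q := by
  classical
  have hδPP := deltaPP_pos d ha
  have hδu := deltaU_pos d ha
  have hN : (0 : ℝ) < ((n : ℝ) + 1) ^ d := by positivity
  -- (0) summability of the fine series, from the block majorant of `P(p,·)` and boundedness of `P(·,q)`
  have hPq : ∀ r : X d, |Pker n a r q| ≤ cPP d n a := fun r => by
    refine (abs_Pker_le n ha r q).trans ?_
    have he : Real.exp (-(deltaPP d a * dist (blk n r) (blk n q))) ≤ 1 := by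
      rw [Real.exp_le_one_iff, neg_nonpos]; exact mul_nonneg hδPP.le dist_nonneg
    have := cPP_nonneg d n ha
    nlinarith
  have hsum : Summable fun r : X d => Pker n a p r * Pker n a r q := by
    refine summable_of_blk_majorant n (C := cPP d n a * cPP d n a) hδPP (blk n p) fun r => ?_
    rw [abs_mul]
    calc |Pker n a p r| * |Pker n a r q|
        ≤ (cPP d n a * Real.exp (-(deltaPP d a * dist (blk n p) (blk n r)))) * cPP d n a :=
          mul_le_mul (abs_Pker_le n ha p r) (hPq r) (abs_nonneg _) (by have := cPP_nonneg d n ha; positivity)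
      _ = _ := by ring
  -- (1) block by block, with `P(r,q) = (n+1)^{−d}·Σ'_y (G′Q′*C)(q,y)(G′Q′*)(r,y)` inside each block
  rw [← tsum_blocks n hsum]
  have hblock : ∀ w : X d, ∑ r ∈ B n w, Pker n a p r * Pker n a r q
      = (((n : ℝ) + 1) ^ d)⁻¹ * ∑' y : X d, (∑ r ∈ B n w, Pker n a p r * gq n a r y) * kerP n a q y := by
    intro w
    have hs : ∀ r ∈ B n w, Summable fun y : X d => Pker n a p r * (kerP n a q y * gq n a r y) :=
      fun r _ => (summable_Pker n ha q r).mul_left _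
    calc ∑ r ∈ B n w, Pker n a p r * Pker n a r q
        = ∑ r ∈ B n w, (((n : ℝ) + 1) ^ d)⁻¹ * ∑' y : X d, Pker n a p r * (kerP n a q y * gq n a r y) := by
          refine Finset.sum_congr rfl fun r _ => ?_
          have hq : Pker n a q r = (((n : ℝ) + 1) ^ d)⁻¹ * ∑' y : X d, kerP n a q y * gq n a r y := rfl
          rw [Pker_symm n ha r q, hq, tsum_mul_left]; ring
      _ = (((n : ℝ) + 1) ^ d)⁻¹ * ∑' y : X d, ∑ r ∈ B n w, Pker n a p r * (kerP n a q y * gq n a r y) := by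
          rw [← Finset.mul_sum, Summable.tsum_finsetSum hs]
      _ = (((n : ℝ) + 1) ^ d)⁻¹ * ∑' y : X d, (∑ r ∈ B n w, Pker n a p r * gq n a r y) * kerP n a q y := by
          refine congrArg _ (tsum_congr fun y => ?_)
          rw [Finset.sum_mul]; exact Finset.sum_congr rfl fun r _ => by ring
  simp_rw [hblock]
  rw [tsum_mul_left]
  -- (2) Fubini in (w, y) under the majorant of `abs_sum_B_Pker_mul_gq_le` × boundedness of `G′Q′*C`
  have hkP : ∀ y : X d, |kerP n a q y| ≤ cP d n a := fun y => by
    refine (abs_kerP_le n ha q y).trans ?_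
    have he : Real.exp (-(deltaP d a * dist (blk n q) y)) ≤ 1 := by
      rw [Real.exp_le_one_iff, neg_nonpos]; exact mul_nonneg (deltaP_pos d ha).le dist_nonneg
    have := cP_nonneg d n ha
    nlinarith
  have hmaj : ∀ w y : X d, |(1 : ℝ) * ((∑ r ∈ B n w, Pker n a p r * gq n a r y) * kerP n a q y)|
      ≤ (((n : ℝ) + 1) ^ d * cPP d n a * (cU d a * Real.sqrt (((n : ℝ) + 1) ^ d)) * cP d n a)
        * Real.exp (-(deltaPP d a * dist (blk n p) w)) * Real.exp (-(deltaU d a * dist w y)) := by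
    intro w y
    rw [one_mul, abs_mul]
    calc |∑ r ∈ B n w, Pker n a p r * gq n a r y| * |kerP n a q y|
        ≤ ((((n : ℝ) + 1) ^ d * cPP d n a * (cU d a * Real.sqrt (((n : ℝ) + 1) ^ d)))
            * Real.exp (-(deltaPP d a * dist (blk n p) w)) * Real.exp (-(deltaU d a * dist w y))) * cP d n a :=
          mul_le_mul (abs_sum_B_Pker_mul_gq_le n ha p w y) (hkP y) (abs_nonneg _)
            (by have := cPP_nonneg d n ha; have := cU_pos d ha; positivity)
      _ = _ := by ring
  have hswap := tsum_mul_tsum_comm (f := fun _ : X d => (1 : ℝ))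
    (g := fun w y => (∑ r ∈ B n w, Pker n a p r * gq n a r y) * kerP n a q y) hδPP hδu (blk n p) hmaj
  simp only [one_mul] at hswap
  rw [hswap]
  -- (3) for fixed `y` the block pieces re-assemble to `Σ'_r P(p,r)(G′Q′*)(r,y) = (G′Q′*)(p,y)` (`tsum_gq_mul_Pker`)
  have hcol : ∀ y : X d, ∑' w : X d, (∑ r ∈ B n w, Pker n a p r * gq n a r y) * kerP n a q y
      = kerP n a q y * gq n a p y := by
    intro y
    have hs : Summable fun r : X d => Pker n a p r * gq n a r y := by
      have e : (fun r : X d => Pker n a p r * gq n a r y) = fun r => gq n a r y * Pker n a r p := by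
        funext r; rw [Pker_symm n ha p r, mul_comm]
      rw [e]; exact summable_gq_mul_Pker n ha y p
    rw [tsum_mul_right, tsum_blocks n hs]
    have e2 : ∑' r : X d, Pker n a p r * gq n a r y = gq n a p y := by
      rw [← tsum_gq_mul_Pker n ha y p]
      exact tsum_congr fun r => by rw [Pker_symm n ha p r, mul_comm]
    rw [e2, mul_comm]
  simp_rw [hcol]
  rw [Pker_symm n ha p q, Pker]

/-! ## §4 Road currency -/

/-- [folklore] `Pgt n a` (`d = 4`, block side `n`, `D1BFx/RProjector` §5) is idempotent: `Σ'_z Pgt x z · Pgt z y = Pgt x y`. -/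
theorem tsum_Pgt_mul_Pgt (n : ℕ) {a : ℝ} (ha : 0 < a) (x y : X 4) (u v : Unit) :
    ∑' z : X 4, Pgt n a x z u () * Pgt n a z y () v = Pgt n a x y u v := by
  simp only [Pgt_apply]
  exact tsum_Pker_mul_Pker (n - 1) ha x y

/-- [folklore] `Q′G′·Pgt = Q′G′` in the road currency: `Σ'_z (G′Q′*)(z,w)·Pgt z y = (G′Q′*)(y,w)` (`G′Q′*` = `gq (n−1) a` over the
typer's `Ggh n a = Gk (n−1) a`). -/
theorem tsum_gq_mul_Pgt (n : ℕ) {a : ℝ} (ha : 0 < a) (w y : X 4) (v : Unit) :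
    ∑' z : X 4, gq (n - 1) a z w * Pgt n a z y () v = gq (n - 1) a y w := by
  simp only [Pgt_apply]
  exact tsum_gq_mul_Pker (n - 1) ha w y

end

end Summit.QuantumFields.BalabanUV.Beta.D1BFx.RProjectorRange
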